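import Summits.ABC.ABC.Theorems.IsogenyGlueCongruencePolyDegreeOfBoundedPrimesHeightCalibrationExact
import Literature.NumberTheory.DiophantineGeometry.StrongHall

/-!
# Sketch — crux idea `mordell-twist-cm-height` for crux stmt-ABC-16006
(`PolyHeightOfBoundedPrimes`, B′ = A → H, route IsogenyGlueCongruence)

First-lemma signatures over existing declarations (planner crux-ideate, k = 2, round 1).
`sorry` only in the two `stub_*` statements; the composition `crux_of_polyStrongHall`
concludes the crux BY NAME.
-/

noncomputable section

set_option linter.dupNamespace false

namespace Summit.ABC.ABC.Cruxes.PolyHeightOfBoundedPrimes.MordellTwist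

open IsDedekindDomain WeierstrassCurve UniqueFactorizationMonoid
open Literature.NumberTheory.DiophantineGeometry Literature.NumberTheory.EllipticCurves
open Summit.ABC.ABC.Theses.IsogenyGlueCongruence

/-- **C⁺ (transfer target).** POLYNOMIAL strong Hall = polynomial Lang–Hall conjecture for the
Mordell family `y² = x³ − z`: every primitive solution of `x³ − y² = z ≠ 0` (B–G 12.5.2,
`IsPrimitiveHallSolution`) satisfies `max(|x|³, |z|) ≤ C · rad(z)^A` for ABSOLUTE `A, C`.
(B–G Conj. 12.5.3 is the sharp form `A = 6 + ε` on the `|x|³` side; here the exponent is free.)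
Equivalently: the integral point `(x, y)` of the Mordell curve `M_z : Y² = X³ − z` has Néron–Tate
height `ĥ_{M_z}(x,y) = (1/6) log max(|x|³,|z|) + O(1) ≤ (A/6) log rad z + C'`. -/
def PolyStrongHall : Prop :=
  ∃ A C : ℝ, ∀ x y z : ℤ, IsPrimitiveHallSolution x y z →
    ((max (|x| ^ 3) |z| : ℤ) : ℝ) ≤ C * ((radical z.natAbs : ℕ) : ℝ) ^ A

/-- **C⁺′ (the semistable shadow).** Coprime-away-from-6 Hall–Szpiro: for `x³ − y² = z ≠ 0` with
no prime `p ≥ 5` dividing both `x` and `y`, `max(|x|³,|z|) ≤ C · rad(z)^A`. This is exactly what a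
SEMISTABLE global minimal model delivers with `(x, y, z) = (c₄, c₆, 1728 Δ)` (a prime `p ≥ 5` dividing
`c₄` and `Δ` is a prime of additive reduction; tree: "Semistable at `p` ⟹ `p ∤ Δ_min` or `p ∤ c₄`"). -/
def CoprimeHallSzpiro : Prop :=
  ∃ A C : ℝ, ∀ x y z : ℤ, x ^ 3 - y ^ 2 = z → z ≠ 0 →
    (∀ p : ℕ, p.Prime → (p : ℤ) ∣ x → (p : ℤ) ∣ y → p ≤ 3) →
    ((max (|x| ^ 3) |z| : ℤ) : ℝ) ≤ C * ((radical z.natAbs : ℕ) : ℝ) ^ A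

/-- Polynomial generalized Szpiro over `ℤ`-models (B–G Conj. 12.5.11 with the exponent `6 + ε`
replaced by a free `σ`; same binders as `GeneralizedSzpiroConjectureBG`). -/
def PolyGeneralizedSzpiroBG : Prop :=
  ∃ σ C : ℝ, ∀ W₀ : WeierstrassCurve ℤ, (W₀.baseChange ℚ).IsElliptic →
    (∀ v : HeightOneSpectrum ℤ, (W₀.baseChange ℚ).IsMinimalAt v) →
      ((max |W₀.Δ| (|W₀.c₄| ^ 3) : ℤ) : ℝ) ≤ C * ((W₀.baseChange ℚ).conductorNorm ℤ : ℝ) ^ σ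

/-- `H`, the consequent of the crux, verbatim. -/
def PolyHeight : Prop :=
  ∃ σ C : ℝ, ∀ (W : WeierstrassCurve ℚ) [W.IsElliptic] [W.IsGloballyMinimal]
    [NeZero (W.conductorNorm ℤ)], W.IsSemistable ℤ →
    ((max |W.Δ| (|W.c₄| ^ 3) : ℚ) : ℝ) ≤ C * (W.conductorNorm ℤ : ℝ) ^ σ

/-- Sanity: `PolyHeight` is literally the consequent of the crux. -/
example : PolyHeightOfBoundedPrimes ↔ (DegreePrimesPolyBounded → PolyHeight) := Iff.rfl

/-- **FIRST LEMMA (glue 1, provable now).** Polynomial strong Hall ⟹ polynomial generalized Szpiro: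
adapt `Literature.NumberTheory.EllipticCurves.generalizedSzpiroBG_of_strongHall` (B–G Thm 12.5.12 (b) ⟹ (c),
LANDED for the exponent `6 + ε`) with `e := 6 + ε` replaced by the free exponent (output `σ = 3A`:
`Γ = gcd(c₄³,c₆²) = Γ' g⁶`, `g ≪ rad Γ`, `rad(Δ) rad(Γ) ≤ 6·cond`). -/
theorem stub_polyGenSzpiro_of_polyStrongHall : PolyStrongHall → PolyGeneralizedSzpiroBG := by
  sorry

/-- **Alternative first lemma (glue 1′, provable now, shorter).** The semistable shadow suffices for `H`
directly: on a semistable global minimal model no prime `p ≥ 5` divides both `c₄` and `c₆`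
(it would divide `Δ` and `c₄`: additive), `1728 Δ = c₄³ − c₆²` (`WeierstrassCurve.c_relation`) and
`rad(1728 Δ) ≤ 6 · N`. -/
theorem stub_polyHeight_of_coprimeHallSzpiro : CoprimeHallSzpiro → PolyHeight := by
  sorry

/-- Glue 2 (PROVED; copy of `Summit.ABC.ABC.Theorems.polyHeight_of_generalizedSzpiroBG` with a free
exponent): `ℤ`-model polynomial generalized Szpiro ⟹ `H`. -/
theorem polyHeight_of_polyGenSzpiro (h : PolyGeneralizedSzpiroBG) : PolyHeight := by
  obtain ⟨σ, C, hC⟩ := h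
  refine ⟨σ, C, fun W _ _ _ _ ↦ ?_⟩
  set W₀ : WeierstrassCurve ℤ := integralModelInt W with hW₀def
  have hW₀ : W₀.baseChange ℚ = W := baseChange_integralModelInt W
  have hell : (W₀.baseChange ℚ).IsElliptic := by rw [hW₀]; infer_instance
  have hmin : ∀ v : HeightOneSpectrum ℤ, (W₀.baseChange ℚ).IsMinimalAt v := fun v ↦ by
    rw [hW₀]; exact IsGloballyMinimal.isMinimalAt_int W v
  have hσ := hC W₀ hell hmin
  rw [hW₀] at hσ
  have hq : (max |W.Δ| (|W.c₄| ^ 3) : ℚ) = ((max |W₀.Δ| (|W₀.c₄| ^ 3) : ℤ) : ℚ) := by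
    rw [← cast_integralModelInt_Δ W, ← cast_integralModelInt_c₄ W]
    push_cast
    rfl
  rw [hq, Rat.cast_intCast]
  exact hσ

/-- The line concludes the crux BY NAME (the hypothesis `A = DegreePrimesPolyBounded` is idle — the
card's `Transfer:` explains why no use of it is known). -/
theorem crux_of_polyStrongHall (h : PolyStrongHall) : PolyHeightOfBoundedPrimes :=
  fun _ => polyHeight_of_polyGenSzpiro (stub_polyGenSzpiro_of_polyStrongHall h)

/-- Same through the semistable shadow. -/
theorem crux_of_coprimeHallSzpiro (h : CoprimeHallSzpiro) : PolyHeightOfBoundedPrimes :=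
  fun _ => stub_polyHeight_of_coprimeHallSzpiro h

/-- Bookkeeping (PROVED): the full form implies the semistable shadow on coprime-away-from-6 inputs is
NOT automatic (a common factor `2^a 3^b` with `6 ∣ …` breaks primitivity), so the two stubs are kept
separate; but primitive solutions are in particular covered by `PolyStrongHall`, and conversely every
coprime-away-from-6 solution reduces to a primitive one after dividing by `g⁶`, `g ∣ 6^∞` — recorded
informally, not needed by the composition. -/
example : True := trivial

end Summit.ABC.ABC.Cruxes.PolyHeightOfBoundedPrimes.MordellTwist
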